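import Literature.MathematicalPhysics.QuantumFieldTheory.Balaban1983to89.Node00.BgHierFrameOfRecord
import Literature.MathematicalPhysics.QuantumFieldTheory.Balaban1983to89.BlockAveragingSU2FirstOrder
import Literature.MathematicalPhysics.QuantumFieldTheory.Balaban1983to89.B7TransferAnalyticMean
import Summits.QuantumFields.YangMills.Theorems.BalabanUVNodesC44IterMhStabilityAlgebra
import HarnessLib

/-!
# [B7] (84)–(87), ONE LEVEL: THE HIERARCHICAL FRAME STEP `(Φ_j, Ψ_j) ↦ (Φ_{j+1}, Ψ_{j+1})` PROPAGATES THE NEAR-ONE BOUND WITH NO GROWTH FACTOR —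
# `‖Φ_{j+1}(y) − 1‖, ‖Ψ_{j+1}(y) − 1‖ ≤ θ + τ + 20(θ + τ)²` from `‖Φ_j − 1‖, ‖Ψ_j − 1‖ ≤ θ` on `{ey} ∪ B(y)` and contour dressings `‖Z(Γ_{y,x})·W(Γ_{y,x})⋆ − 1‖ ≤ τ`

Cell `pub-ymgap` ∕ `ym-nodeO-ideate`, porter lineage `ymgap-nodeO-port-PTB-1` (gen 10); director-ym g24 №628 (2)–(3): the first brick of (T1)∕(T2) (window ∕ near-one bound of
node00-def-Y's `hierFrameDatumOfRecord`, owned by this lineage).  `--kind proof --supports stmt-QuantumFields-27238 --as helper`; count-neutral; NEW basename; generic over the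
averaging data (`Z`, `W`, `Θ` arbitrary).  [B7] = [Balaban1985Averaging].

THE POINT (why the level recursion has no growth factor).  One step of (85)–(87) reads, at a coarse site `y` with `a := Φ_j(ey)`, `a′ := Ψ_j(ey) = a⁻¹`,
`A_x := a′ · Z(Γ_{y,x}) · Φ_j(x) · W(Γ_{y,x})⋆ = a′ · P_x · Q_x`, `P_x := Z(Γ)W(Γ)⋆` (the contour dressing, `‖P_x − 1‖ ≤ τ`), `Q_x := W(Γ)Φ_j(x)W(Γ)⋆` (a unitary conjugate,
`‖Q_x − 1‖ = ‖Φ_j(x) − 1‖ ≤ θ`); `E(y) = L^{-d} Σ_x log A_x = (a′ − 1) + L^{-d}Σ_x[(P_x − 1) + (Q_x − 1)] + O((θ+τ)²)`, and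
`Φ_{j+1}(y) − 1 = a·e^{E} − 1 = [(a − 1) + (a′ − 1)] + (E − (a′ − 1)) + (a − 1)E + a(e^E − 1 − E)` with the EXACT CANCELLATION `(a − 1) + (a⁻¹ − 1) = −(a⁻¹ − 1)(a − 1) = O(θ²)`:
the centre value of the old frame drops out to first order and what remains is a BLOCK MEAN of deviations (norm ≤ θ + τ) plus explicit quadratic terms.  Print: (89) p.31 and the
discussion (101)–(106) p.33; here in the complex sup-norm currency of PT-B's (44) files.

WHAT IS PROVED (0 def, 0 sorry, axioms standard; ns `Summit.QuantumFields.YangMills.Theorems.C44IterMh`).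
* §1 algebra: `add_sub_one_eq_of_mul_eq_one` (the cancellation), `norm_invLd_smul_sum_le` (a block mean is bounded by the max), `invLd_smul_sum_sub_const`, `frameArg_eq_dress_conj`
  (`A_x = a′·P_x·Q_x`), `norm_frameArg_sub_one_sub_lin_le` ∕ ★`norm_frameArg_sub_one_le` (`‖A_x − 1‖ ≤ (2θ+τ) + (2θ+τ)²` — the window letter of (81)∕(85)),
  `norm_mlog_frameArg_sub_le` (`‖log A_x − (a′ − 1)‖ ≤ θ + τ + 9(θ+τ)²`), `norm_frameExpo_sub_le`.
* §2 ★★★ `norm_frameStep_fst_sub_one_le` ∕ ★★★ `norm_frameStep_snd_sub_one_le`: `‖Φ_{j+1}(y) − 1‖, ‖Ψ_{j+1}(y) − 1‖ ≤ θ + τ + 20(θ+τ)²` for `θ + τ ≤ 1∕50`.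

HONEST FRAMING.  Matrix bookkeeping (products of near-identity factors, `log`∕`exp` to second order over landed lit lemmas); the inputs θ (previous level) and τ (contour dressing,
[B7] (47)∕(111)) are DISPLAYED; the tower induction and the record's instantiation are the next files; nothing of [B7] Prop. 5 ∕ (101)–(112)'s Hölder bounds, [B11] Prop. 4 is
proved here; K0ᴬ ⟨stmt-QuantumFields-27238⟩ NOT closed; NODE O 0∕1; COUNT 8∕28 · K 1∕4 UNMOVED; finite `𝕋⁴_{L^K}` at fixed ε — NOT continuum ∕ OS ∕ Clay; **the Yang–Mills mass gap
(Clay) is NOT proved by any of this.**  No `sorry`, `instance`, `notation`, `set_option`; standard axioms.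
-/

noncomputable section

open scoped Matrix Matrix.Norms.L2Operator Topology

namespace Summit.QuantumFields.YangMills.Theorems.C44IterMh

open Literature.MathematicalPhysics.QuantumFieldTheory.Balaban1983to89
open Literature.MathematicalPhysics.QuantumFieldTheory.Balaban1983to89.Node00
open T4Continuum BlockAveraging
open B15AveragingHolomorphic (holMh)
open MatrixLog (mlog norm_mlog_sub_sub_one_le_sq)
open B7TransferAnalyticMean (norm_exp_sub_one_sub_self_le norm_exp_sub_one_le_two_mul)
open NormedSpace (exp)

/-! ## §1  Algebra of one step -/

section Algebra

variable {N : ℕ}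

/-- ★ **THE CANCELLATION**: `a′a = 1 ⟹ (a − 1) + (a′ − 1) = −((a′ − 1)(a − 1))` — the centre value of the previous frame drops out of `Φ_j(ey)·exp E(y)` to first order.
[cite: Balaban1985Averaging, (86)–(87) p.31, (89) p.31] -/
theorem add_sub_one_eq_of_mul_eq_one {𝔸 : Type*} [Ring 𝔸] {a a' : 𝔸} (h : a' * a = 1) : (a - 1) + (a' - 1) = -((a' - 1) * (a - 1)) := by
  simp only [sub_mul, mul_sub, h, one_mul, mul_one]
  abel

/-- A block mean is bounded by the maximum of its terms: `‖L^{-d} Σ_x f(x)‖ ≤ B` if every `‖f(x)‖ ≤ B`. [cite: Balaban1985Averaging, (79) p.30 (bookkeeping)] -/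
theorem norm_invLd_smul_sum_le {M : Type*} [SeminormedAddCommGroup M] [NormedSpace ℂ M] {d L : ℕ} (hL : 0 < L) (f : (Fin d → Fin L) → M) {B : ℝ}
    (h : ∀ r, ‖f r‖ ≤ B) : ‖((L : ℂ) ^ d)⁻¹ • ∑ r, f r‖ ≤ B := by
  have hLd : (0 : ℝ) < (L : ℝ) ^ d := pow_pos (by exact_mod_cast hL) d
  have hcard : (Fintype.card (Fin d → Fin L) : ℝ) = (L : ℝ) ^ d := by
    rw [Fintype.card_fun, Fintype.card_fin, Fintype.card_fin, Nat.cast_pow]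
  have hsum : ‖∑ r, f r‖ ≤ (L : ℝ) ^ d * B := by
    refine (norm_sum_le _ _).trans ?_
    calc ∑ r, ‖f r‖ ≤ ∑ _r : Fin d → Fin L, B := Finset.sum_le_sum fun r _ => h r
      _ = (L : ℝ) ^ d * B := by rw [Finset.sum_const, Finset.card_univ, nsmul_eq_mul, hcard]
  rw [norm_smul, norm_inv, norm_pow, Complex.norm_natCast, inv_mul_le_iff₀ hLd]
  exact hsum

/-- `L^{-d} Σ_x (f(x) − c) = L^{-d} Σ_x f(x) − c` (there are `L^d` sites in a block). [cite: Balaban1985Averaging, (79) p.30 (bookkeeping)] -/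
theorem invLd_smul_sum_sub_const {M : Type*} [AddCommGroup M] [Module ℂ M] {d L : ℕ} (hL : 0 < L) (f : (Fin d → Fin L) → M) (c : M) :
    ((L : ℂ) ^ d)⁻¹ • ∑ r, (f r - c) = ((L : ℂ) ^ d)⁻¹ • ∑ r, f r - c := by
  have hLd : ((L : ℂ) ^ d) ≠ 0 := pow_ne_zero _ (by exact_mod_cast hL.ne')
  rw [Finset.sum_sub_distrib, Finset.sum_const, Finset.card_univ, Fintype.card_fun, Fintype.card_fin, Fintype.card_fin, smul_sub,
    ← Nat.cast_smul_eq_nsmul ℂ, smul_smul, Nat.cast_pow, inv_mul_cancel₀ hLd, one_smul]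

variable [NeZero N] {P : Params} {j : ℕ}

/-- The background transporter along a centre contour is unitary. [cite: Balaban1985Averaging, (42) p.23 (bookkeeping)] -/
theorem coe_ctrHol_mem_unitaryGroup (W : GaugeField P j (SU N)) (y : Site P (j + 1)) (r : Fin P.d → Fin P.L) :
    ((ctrHol W y r : SU N) : Matrix (Fin N) (Fin N) ℂ) ∈ Matrix.unitaryGroup (Fin N) ℂ :=
  Matrix.specialUnitaryGroup_le_unitaryGroup (ctrHol W y r).2

/-- **`A_x = a′ · P_x · Q_x`**: the argument of the logarithm in (85) is the old inverse frame at the centre times the contour DRESSING `P_x = Z(Γ)W(Γ)⋆` times the unitary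
conjugate `Q_x = W(Γ)Φ_j(x)W(Γ)⋆` of the old frame at `x`. [cite: Balaban1985Averaging, (78) p.30, (85) p.30, (58) p.27] -/
theorem frameArg_eq_dress_conj (Z : PBond P j → Matrix (Fin N) (Fin N) ℂ) (W : GaugeField P j (SU N))
    (Θ : Site P j → Matrix (Fin N) (Fin N) ℂ × Matrix (Fin N) (Fin N) ℂ) (y : Site P (j + 1)) (r : Fin P.d → Fin P.L) :
    frameArg Z W Θ y r =
      (Θ (emb y)).2 * (ctrHolM Z y r * star ((ctrHol W y r : SU N) : Matrix (Fin N) (Fin N) ℂ)) *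
        (((ctrHol W y r : SU N) : Matrix (Fin N) (Fin N) ℂ) * (Θ (Site.blockSite y r)).1 * star ((ctrHol W y r : SU N) : Matrix (Fin N) (Fin N) ℂ)) := by
  have hU := Unitary.star_mul_self_of_mem (coe_ctrHol_mem_unitaryGroup W y r)
  rw [frameArg]
  rw [show (Θ (emb y)).2 * (ctrHolM Z y r * star ((ctrHol W y r : SU N) : Matrix (Fin N) (Fin N) ℂ)) *
        (((ctrHol W y r : SU N) : Matrix (Fin N) (Fin N) ℂ) * (Θ (Site.blockSite y r)).1 * star ((ctrHol W y r : SU N) : Matrix (Fin N) (Fin N) ℂ))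
      = (Θ (emb y)).2 * ctrHolM Z y r * (star ((ctrHol W y r : SU N) : Matrix (Fin N) (Fin N) ℂ) * ((ctrHol W y r : SU N) : Matrix (Fin N) (Fin N) ℂ)) *
        (Θ (Site.blockSite y r)).1 * star ((ctrHol W y r : SU N) : Matrix (Fin N) (Fin N) ℂ) by simp only [mul_assoc],
    hU, mul_one]

/-- **THE ARGUMENT OF THE LOGARITHM TO FIRST ORDER**: `‖A_x − 1 − ((a′ − 1) + (P_x − 1) + (Q_x − 1))‖ ≤ (2θ + τ)²` (three near-identity factors).
[cite: Balaban1985Averaging, (85) p.30, (111)–(112) p.34] -/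
theorem norm_frameArg_sub_one_sub_lin_le (Z : PBond P j → Matrix (Fin N) (Fin N) ℂ) (W : GaugeField P j (SU N))
    (Θ : Site P j → Matrix (Fin N) (Fin N) ℂ × Matrix (Fin N) (Fin N) ℂ) (y : Site P (j + 1)) (r : Fin P.d → Fin P.L) {θ τ : ℝ}
    (hθ2 : ‖(Θ (emb y)).2 - 1‖ ≤ θ) (hθx : ‖(Θ (Site.blockSite y r)).1 - 1‖ ≤ θ)
    (hτ : ‖ctrHolM Z y r * star ((ctrHol W y r : SU N) : Matrix (Fin N) (Fin N) ℂ) - 1‖ ≤ τ) (hs : 2 * θ + τ ≤ 1) :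
    ‖frameArg Z W Θ y r - 1 -
        (((Θ (emb y)).2 - 1) + (ctrHolM Z y r * star ((ctrHol W y r : SU N) : Matrix (Fin N) (Fin N) ℂ) - 1) +
          (((ctrHol W y r : SU N) : Matrix (Fin N) (Fin N) ℂ) * (Θ (Site.blockSite y r)).1 * star ((ctrHol W y r : SU N) : Matrix (Fin N) (Fin N) ℂ) - 1))‖
      ≤ (2 * θ + τ) ^ 2 := by
  have hθ0 : 0 ≤ θ := (norm_nonneg _).trans hθ2
  have hτ0 : 0 ≤ τ := (norm_nonneg _).trans hτ
  have hQ : ‖((ctrHol W y r : SU N) : Matrix (Fin N) (Fin N) ℂ) * (Θ (Site.blockSite y r)).1 * star ((ctrHol W y r : SU N) : Matrix (Fin N) (Fin N) ℂ) - 1‖ ≤ θ := by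
    rw [norm_unitary_conj_sub_one_eq (coe_ctrHol_mem_unitaryGroup W y r)]; exact hθx
  have h1 : ‖(1 : Matrix (Fin N) (Fin N) ℂ) - 1‖ ≤ 0 := by rw [sub_self, norm_zero]
  have h := norm_mul4_sub_one_sub_sum_le hθ2 hτ hQ h1
  rw [frameArg_eq_dress_conj]
  rw [mul_one, sub_self, add_zero] at h
  refine h.trans ?_
  have hsq := prod4_sub_one_sub_sum_le_sq hθ0 hτ0 hθ0 le_rfl (by linarith)
  calc (1 + θ) * (1 + τ) * (1 + θ) * (1 + 0) - 1 - (θ + τ + θ + 0) ≤ (θ + τ + θ + 0) ^ 2 := hsq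
    _ = (2 * θ + τ) ^ 2 := by ring

/-- ★ **THE WINDOW LETTER OF (81)∕(85)**: `‖A_x − 1‖ ≤ (2θ + τ) + (2θ + τ)²` (in particular `< 1`, so `log A_x` is the analytic branch).
[cite: Balaban1985Averaging, (81) p.30, (85) p.30] -/
theorem norm_frameArg_sub_one_le (Z : PBond P j → Matrix (Fin N) (Fin N) ℂ) (W : GaugeField P j (SU N))
    (Θ : Site P j → Matrix (Fin N) (Fin N) ℂ × Matrix (Fin N) (Fin N) ℂ) (y : Site P (j + 1)) (r : Fin P.d → Fin P.L) {θ τ : ℝ}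
    (hθ2 : ‖(Θ (emb y)).2 - 1‖ ≤ θ) (hθx : ‖(Θ (Site.blockSite y r)).1 - 1‖ ≤ θ)
    (hτ : ‖ctrHolM Z y r * star ((ctrHol W y r : SU N) : Matrix (Fin N) (Fin N) ℂ) - 1‖ ≤ τ) (hs : 2 * θ + τ ≤ 1) :
    ‖frameArg Z W Θ y r - 1‖ ≤ (2 * θ + τ) + (2 * θ + τ) ^ 2 := by
  have hQ : ‖((ctrHol W y r : SU N) : Matrix (Fin N) (Fin N) ℂ) * (Θ (Site.blockSite y r)).1 * star ((ctrHol W y r : SU N) : Matrix (Fin N) (Fin N) ℂ) - 1‖ ≤ θ := by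
    rw [norm_unitary_conj_sub_one_eq (coe_ctrHol_mem_unitaryGroup W y r)]; exact hθx
  have h := norm_frameArg_sub_one_sub_lin_le Z W Θ y r hθ2 hθx hτ hs
  have hlin : ‖((Θ (emb y)).2 - 1) + (ctrHolM Z y r * star ((ctrHol W y r : SU N) : Matrix (Fin N) (Fin N) ℂ) - 1) +
      (((ctrHol W y r : SU N) : Matrix (Fin N) (Fin N) ℂ) * (Θ (Site.blockSite y r)).1 * star ((ctrHol W y r : SU N) : Matrix (Fin N) (Fin N) ℂ) - 1)‖ ≤ 2 * θ + τ := by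
    refine (norm_add₃_le).trans ?_
    linarith
  have := norm_le_insert' (frameArg Z W Θ y r - 1)
    (((Θ (emb y)).2 - 1) + (ctrHolM Z y r * star ((ctrHol W y r : SU N) : Matrix (Fin N) (Fin N) ℂ) - 1) +
      (((ctrHol W y r : SU N) : Matrix (Fin N) (Fin N) ℂ) * (Θ (Site.blockSite y r)).1 * star ((ctrHol W y r : SU N) : Matrix (Fin N) (Fin N) ℂ) - 1))
  linarith

/-- **THE LOGARITHM TO FIRST ORDER, CENTRED AT THE OLD INVERSE FRAME**: `‖log A_x − (a′ − 1)‖ ≤ θ + τ + 9(θ+τ)²` for `θ + τ ≤ 1∕50` (`log A = (A − 1) + O(‖A − 1‖²)`,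
lit ✓`MatrixLog.norm_mlog_sub_sub_one_le_sq`). [cite: Balaban1985Averaging, (21) p.21, (85) p.30] -/
theorem norm_mlog_frameArg_sub_le (Z : PBond P j → Matrix (Fin N) (Fin N) ℂ) (W : GaugeField P j (SU N))
    (Θ : Site P j → Matrix (Fin N) (Fin N) ℂ × Matrix (Fin N) (Fin N) ℂ) (y : Site P (j + 1)) (r : Fin P.d → Fin P.L) {θ τ : ℝ}
    (hθ2 : ‖(Θ (emb y)).2 - 1‖ ≤ θ) (hθx : ‖(Θ (Site.blockSite y r)).1 - 1‖ ≤ θ)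
    (hτ : ‖ctrHolM Z y r * star ((ctrHol W y r : SU N) : Matrix (Fin N) (Fin N) ℂ) - 1‖ ≤ τ) (hs : θ + τ ≤ 1 / 50) :
    ‖mlog (frameArg Z W Θ y r) - ((Θ (emb y)).2 - 1)‖ ≤ θ + τ + 9 * (θ + τ) ^ 2 := by
  have hθ0 : 0 ≤ θ := (norm_nonneg _).trans hθ2
  have hτ0 : 0 ≤ τ := (norm_nonneg _).trans hτ
  have hs1 : 2 * θ + τ ≤ 1 := by linarith
  have hQ : ‖((ctrHol W y r : SU N) : Matrix (Fin N) (Fin N) ℂ) * (Θ (Site.blockSite y r)).1 * star ((ctrHol W y r : SU N) : Matrix (Fin N) (Fin N) ℂ) - 1‖ ≤ θ := by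
    rw [norm_unitary_conj_sub_one_eq (coe_ctrHol_mem_unitaryGroup W y r)]; exact hθx
  have hlin := norm_frameArg_sub_one_sub_lin_le Z W Θ y r hθ2 hθx hτ hs1
  have hA := norm_frameArg_sub_one_le Z W Θ y r hθ2 hθx hτ hs1
  -- `‖A − 1‖ ≤ ½`, so the logarithm is within `‖A − 1‖²` of `A − 1`
  have hα : (2 * θ + τ) + (2 * θ + τ) ^ 2 ≤ 1 / 2 := by nlinarith
  have hlog := norm_mlog_sub_sub_one_le_sq (hA.trans hα)
  have hlog' : ‖mlog (frameArg Z W Θ y r) - (frameArg Z W Θ y r - 1)‖ ≤ ((2 * θ + τ) + (2 * θ + τ) ^ 2) ^ 2 :=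
    hlog.trans (pow_le_pow_left₀ (norm_nonneg _) hA 2)
  -- assemble: log A − (a′−1) = [log A − (A−1)] + [A − 1 − lin] + [(P−1) + (Q−1)]
  have hsplit : mlog (frameArg Z W Θ y r) - ((Θ (emb y)).2 - 1) =
      (mlog (frameArg Z W Θ y r) - (frameArg Z W Θ y r - 1)) +
      (frameArg Z W Θ y r - 1 -
        (((Θ (emb y)).2 - 1) + (ctrHolM Z y r * star ((ctrHol W y r : SU N) : Matrix (Fin N) (Fin N) ℂ) - 1) +
          (((ctrHol W y r : SU N) : Matrix (Fin N) (Fin N) ℂ) * (Θ (Site.blockSite y r)).1 * star ((ctrHol W y r : SU N) : Matrix (Fin N) (Fin N) ℂ) - 1))) +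
      ((ctrHolM Z y r * star ((ctrHol W y r : SU N) : Matrix (Fin N) (Fin N) ℂ) - 1) +
        (((ctrHol W y r : SU N) : Matrix (Fin N) (Fin N) ℂ) * (Θ (Site.blockSite y r)).1 * star ((ctrHol W y r : SU N) : Matrix (Fin N) (Fin N) ℂ) - 1)) := by abel
  rw [hsplit]
  refine (norm_add₃_le).trans ?_
  have hPQ : ‖(ctrHolM Z y r * star ((ctrHol W y r : SU N) : Matrix (Fin N) (Fin N) ℂ) - 1) +
      (((ctrHol W y r : SU N) : Matrix (Fin N) (Fin N) ℂ) * (Θ (Site.blockSite y r)).1 * star ((ctrHol W y r : SU N) : Matrix (Fin N) (Fin N) ℂ) - 1)‖ ≤ τ + θ :=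
    (norm_add_le _ _).trans (add_le_add hτ hQ)
  -- real arithmetic: `u := 2θ+τ ≤ 2s`, `u ≤ 1∕25`; `(u + u²)² + u² ≤ ((26∕25)² + 1)·u² ≤ 4·2.09·s² ≤ 9 s²`
  have hu0 : 0 ≤ 2 * θ + τ := by positivity
  have hus : 2 * θ + τ ≤ 2 * (θ + τ) := by linarith
  have hu25 : 2 * θ + τ ≤ 1 / 25 := by linarith
  have hu2 : (2 * θ + τ) ^ 2 ≤ 4 * (θ + τ) ^ 2 := by nlinarith
  have hlinq : 2 * θ + τ + (2 * θ + τ) ^ 2 ≤ 26 / 25 * (2 * θ + τ) := by nlinarith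
  have hsq : (2 * θ + τ + (2 * θ + τ) ^ 2) ^ 2 ≤ (26 / 25 * (2 * θ + τ)) ^ 2 := pow_le_pow_left₀ (by positivity) hlinq 2
  nlinarith [hlog', hlin, hPQ, hsq, hu2]

/-- **THE EXPONENT OF (85) TO FIRST ORDER**: `‖E(y) − (a′ − 1)‖ ≤ θ + τ + 9(θ+τ)²` (a block mean of the previous lemma; the constant `a′ − 1` passes through the mean) and
`‖E(y)‖ ≤ 2θ + τ + 9(θ+τ)²`. [cite: Balaban1985Averaging, (79) p.30, (85) p.30] -/
theorem norm_frameExpo_sub_le (Z : PBond P j → Matrix (Fin N) (Fin N) ℂ) (W : GaugeField P j (SU N))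
    (Θ : Site P j → Matrix (Fin N) (Fin N) ℂ × Matrix (Fin N) (Fin N) ℂ) (y : Site P (j + 1)) {θ τ : ℝ}
    (hθ2 : ‖(Θ (emb y)).2 - 1‖ ≤ θ) (hθx : ∀ r : Fin P.d → Fin P.L, ‖(Θ (Site.blockSite y r)).1 - 1‖ ≤ θ)
    (hτ : ∀ r : Fin P.d → Fin P.L, ‖ctrHolM Z y r * star ((ctrHol W y r : SU N) : Matrix (Fin N) (Fin N) ℂ) - 1‖ ≤ τ) (hs : θ + τ ≤ 1 / 50) :
    ‖frameExpo Z W Θ y - ((Θ (emb y)).2 - 1)‖ ≤ θ + τ + 9 * (θ + τ) ^ 2 ∧ ‖frameExpo Z W Θ y‖ ≤ 2 * θ + τ + 9 * (θ + τ) ^ 2 := by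
  have hθ0 : 0 ≤ θ := (norm_nonneg _).trans hθ2
  have hτ0 : 0 ≤ τ := le_trans (norm_nonneg _) (hτ fun _ => 0)
  have hE : frameExpo Z W Θ y - ((Θ (emb y)).2 - 1) = ((P.L : ℂ) ^ P.d)⁻¹ • ∑ r : Fin P.d → Fin P.L, (mlog (frameArg Z W Θ y r) - ((Θ (emb y)).2 - 1)) := by
    rw [frameExpo, invLd_smul_sum_sub_const P.L_pos]
  have h1 : ‖frameExpo Z W Θ y - ((Θ (emb y)).2 - 1)‖ ≤ θ + τ + 9 * (θ + τ) ^ 2 := by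
    rw [hE]
    exact norm_invLd_smul_sum_le P.L_pos _ fun r => norm_mlog_frameArg_sub_le Z W Θ y r hθ2 (hθx r) (hτ r) hs
  refine ⟨h1, ?_⟩
  have := norm_le_insert' (frameExpo Z W Θ y) ((Θ (emb y)).2 - 1)
  linarith

end Algebra

/-! ## §2  The step: no growth factor -/

section Step

variable {N : ℕ} [NeZero N] {P : Params} {j : ℕ}

/-- ★★★ **ONE LEVEL OF (86): `‖Φ_{j+1}(y) − 1‖ ≤ θ + τ + 20(θ + τ)²`** from `‖Φ_j(ey) − 1‖, ‖Ψ_j(ey) − 1‖ ≤ θ`, `Ψ_j(ey)·Φ_j(ey) = 1`, `‖Φ_j(x) − 1‖ ≤ θ` on `B(y)`, and the contour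
dressings `‖Z(Γ_{y,x})W(Γ_{y,x})⋆ − 1‖ ≤ τ`, for `θ + τ ≤ 1∕50`.  `Φ_{j+1}(y) − 1 = [(a−1)+(a′−1)] + (E − (a′−1)) + (a−1)E + a(e^E − 1 − E)`, the first bracket `= −(a′−1)(a−1)`.
[cite: Balaban1985Averaging, (86) p.31, (89) p.31, (101)–(106) p.33] -/
theorem norm_frameStep_fst_sub_one_le (Z : PBond P j → Matrix (Fin N) (Fin N) ℂ) (W : GaugeField P j (SU N))
    (Θ : Site P j → Matrix (Fin N) (Fin N) ℂ × Matrix (Fin N) (Fin N) ℂ) (y : Site P (j + 1)) {θ τ : ℝ}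
    (hinv : (Θ (emb y)).2 * (Θ (emb y)).1 = 1) (hθ1 : ‖(Θ (emb y)).1 - 1‖ ≤ θ) (hθ2 : ‖(Θ (emb y)).2 - 1‖ ≤ θ)
    (hθx : ∀ r : Fin P.d → Fin P.L, ‖(Θ (Site.blockSite y r)).1 - 1‖ ≤ θ)
    (hτ : ∀ r : Fin P.d → Fin P.L, ‖ctrHolM Z y r * star ((ctrHol W y r : SU N) : Matrix (Fin N) (Fin N) ℂ) - 1‖ ≤ τ) (hs : θ + τ ≤ 1 / 50) :
    ‖(frameStep Z W Θ y).1 - 1‖ ≤ θ + τ + 20 * (θ + τ) ^ 2 := by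
  have hθ0 : 0 ≤ θ := (norm_nonneg _).trans hθ2
  have hτ0 : 0 ≤ τ := le_trans (norm_nonneg _) (hτ fun _ => 0)
  set a : Matrix (Fin N) (Fin N) ℂ := (Θ (emb y)).1 with ha
  set a' : Matrix (Fin N) (Fin N) ℂ := (Θ (emb y)).2 with ha'
  set E : Matrix (Fin N) (Fin N) ℂ := frameExpo Z W Θ y with hEdef
  obtain ⟨hm, hEn⟩ := norm_frameExpo_sub_le Z W Θ y hθ2 hθx hτ hs
  -- the step
  have hstep : (frameStep Z W Θ y).1 = a * exp E := rfl
  have hsplit : a * exp E - 1 = -((a' - 1) * (a - 1)) + (E - (a' - 1)) + (a - 1) * E + a * (exp E - 1 - E) := by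
    rw [← add_sub_one_eq_of_mul_eq_one hinv]; noncomm_ring
  rw [hstep, hsplit]
  -- sizes
  have hEn1 : ‖E‖ ≤ 1 := by nlinarith
  have hexp : ‖exp E - 1 - E‖ ≤ ‖E‖ ^ 2 := by
    refine (norm_exp_sub_one_sub_self_le E).trans ?_
    have h := Real.abs_exp_sub_one_sub_id_le (x := ‖E‖) (by rwa [abs_of_nonneg (norm_nonneg _)])
    exact (le_abs_self _).trans h
  have han : ‖a‖ ≤ 1 + θ := by
    have := norm_le_insert' a 1; rw [norm_one] at this; linarith [norm_sub_rev a 1]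
  have t1 : ‖-((a' - 1) * (a - 1))‖ ≤ θ * θ := by
    rw [norm_neg]; exact (norm_mul_le _ _).trans (mul_le_mul hθ2 hθ1 (norm_nonneg _) hθ0)
  have t3 : ‖(a - 1) * E‖ ≤ θ * ‖E‖ := (norm_mul_le _ _).trans (mul_le_mul_of_nonneg_right hθ1 (norm_nonneg _))
  have t4 : ‖a * (exp E - 1 - E)‖ ≤ (1 + θ) * ‖E‖ ^ 2 := (norm_mul_le _ _).trans (mul_le_mul han hexp (norm_nonneg _) (by linarith))
  have hsum := (norm_add_le _ _).trans (add_le_add ((norm_add₃_le).trans (add_le_add (add_le_add t1 hm) t3)) t4)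
  refine hsum.trans ?_
  -- real arithmetic: `‖E‖ ≤ 2s + 9s² ≤ (109∕50)s`, `θ ≤ s`
  have hE0 := norm_nonneg E
  have hθs : θ ≤ θ + τ := by linarith
  have hEs : ‖E‖ ≤ 109 / 50 * (θ + τ) := by nlinarith
  have q1 : θ * θ ≤ (θ + τ) * (θ + τ) := mul_le_mul hθs hθs hθ0 (by linarith)
  have q3 : θ * ‖E‖ ≤ (θ + τ) * (109 / 50 * (θ + τ)) := mul_le_mul hθs hEs hE0 (by linarith)
  have q4a : ‖E‖ ^ 2 ≤ (109 / 50 * (θ + τ)) ^ 2 := pow_le_pow_left₀ hE0 hEs 2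
  have q4 : (1 + θ) * ‖E‖ ^ 2 ≤ (1 + 1 / 50) * (109 / 50 * (θ + τ)) ^ 2 := mul_le_mul (by linarith) q4a (sq_nonneg _) (by norm_num)
  nlinarith [q1, q3, q4]

/-- ★★★ **ONE LEVEL OF (87): `‖Ψ_{j+1}(y) − 1‖ ≤ θ + τ + 20(θ + τ)²`** (`Ψ_{j+1}(y) − 1 = e^{−E}a′ − 1 = −(E − (a′−1)) − E(a′−1) + (e^{−E} − 1 + E)a′`).
[cite: Balaban1985Averaging, (87) p.31, (89) p.31, (101)–(106) p.33] -/
theorem norm_frameStep_snd_sub_one_le (Z : PBond P j → Matrix (Fin N) (Fin N) ℂ) (W : GaugeField P j (SU N))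
    (Θ : Site P j → Matrix (Fin N) (Fin N) ℂ × Matrix (Fin N) (Fin N) ℂ) (y : Site P (j + 1)) {θ τ : ℝ}
    (hθ2 : ‖(Θ (emb y)).2 - 1‖ ≤ θ) (hθx : ∀ r : Fin P.d → Fin P.L, ‖(Θ (Site.blockSite y r)).1 - 1‖ ≤ θ)
    (hτ : ∀ r : Fin P.d → Fin P.L, ‖ctrHolM Z y r * star ((ctrHol W y r : SU N) : Matrix (Fin N) (Fin N) ℂ) - 1‖ ≤ τ) (hs : θ + τ ≤ 1 / 50) :
    ‖(frameStep Z W Θ y).2 - 1‖ ≤ θ + τ + 20 * (θ + τ) ^ 2 := by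
  have hθ0 : 0 ≤ θ := (norm_nonneg _).trans hθ2
  have hτ0 : 0 ≤ τ := le_trans (norm_nonneg _) (hτ fun _ => 0)
  set a' : Matrix (Fin N) (Fin N) ℂ := (Θ (emb y)).2 with ha'
  set E : Matrix (Fin N) (Fin N) ℂ := frameExpo Z W Θ y with hEdef
  obtain ⟨hm, hEn⟩ := norm_frameExpo_sub_le Z W Θ y hθ2 hθx hτ hs
  have hstep : (frameStep Z W Θ y).2 = exp (-E) * a' := rfl
  have hsplit : exp (-E) * a' - 1 = -(E - (a' - 1)) + -(E * (a' - 1)) + (exp (-E) - 1 - -E) * a' := by noncomm_ring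
  rw [hstep, hsplit]
  have hEn1 : ‖-E‖ ≤ 1 := by rw [norm_neg]; nlinarith
  have hexp : ‖exp (-E) - 1 - -E‖ ≤ ‖E‖ ^ 2 := by
    refine (norm_exp_sub_one_sub_self_le (-E)).trans ?_
    have h := Real.abs_exp_sub_one_sub_id_le (x := ‖-E‖) (by rwa [abs_of_nonneg (norm_nonneg _)])
    rw [norm_neg] at h ⊢
    exact (le_abs_self _).trans h
  have han : ‖a'‖ ≤ 1 + θ := by
    have := norm_le_insert' a' 1; rw [norm_one] at this; linarith [norm_sub_rev a' 1]
  have t1 : ‖-(E - (a' - 1))‖ ≤ θ + τ + 9 * (θ + τ) ^ 2 := by rw [norm_neg]; exact hm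
  have t2 : ‖-(E * (a' - 1))‖ ≤ ‖E‖ * θ := by rw [norm_neg]; exact (norm_mul_le _ _).trans (mul_le_mul_of_nonneg_left hθ2 (norm_nonneg _))
  have t3 : ‖(exp (-E) - 1 - -E) * a'‖ ≤ ‖E‖ ^ 2 * (1 + θ) := (norm_mul_le _ _).trans (mul_le_mul hexp han (norm_nonneg _) (sq_nonneg _))
  have hsum := (norm_add₃_le).trans (add_le_add (add_le_add t1 t2) t3)
  refine hsum.trans ?_
  have hE0 := norm_nonneg E
  have hθs : θ ≤ θ + τ := by linarith
  have hEs : ‖E‖ ≤ 109 / 50 * (θ + τ) := by nlinarith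
  have q2 : ‖E‖ * θ ≤ (109 / 50 * (θ + τ)) * (θ + τ) := mul_le_mul hEs hθs hθ0 (by positivity)
  have q3a : ‖E‖ ^ 2 ≤ (109 / 50 * (θ + τ)) ^ 2 := pow_le_pow_left₀ hE0 hEs 2
  have q3 : ‖E‖ ^ 2 * (1 + θ) ≤ (109 / 50 * (θ + τ)) ^ 2 * (1 + 1 / 50) := mul_le_mul q3a (by linarith) (by linarith) (sq_nonneg _)
  nlinarith [q2, q3]

end Step

end Summit.QuantumFields.YangMills.Theorems.C44IterMh

end
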